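import Summits.AtomisticToContinuum.FouriersLaw.Theorems.BondHeatUncertaintyBoundedResponseParityFloorProofB
import HarnessLib

/-!
# NODE 95 «ParityFloorProof» (lens-1 g95): (L) proved beneath ParityFloor — part 3 of 3 (sequel of `…BondHeatUncertaintyBoundedResponseParityFloorProofB`)

Split for the 400-line cap by the landing lane (hand-2 g35); the module docstring of part 1 (`…BondHeatUncertaintyBoundedResponseParityFloorProofA`) describes the whole node.  Same namespace; all FQNs unchanged.
0 sorry; standard axioms.
-/

noncomputable section
open MeasureTheory ProbabilityTheory Filter Topology Set Function
open scoped NNReal ENNReal ContDiff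
open Literature.MathematicalPhysics.KineticTheory.HeatConduction
open Literature.MathematicalPhysics.KineticTheory OscillatorChain
open Summit.AtomisticToContinuum.FouriersLaw.Theorems.SubdiffusiveBondHeat
open Summit.AtomisticToContinuum.FouriersLaw.Theorems.OddSectorIrreversibility
open Summit.AtomisticToContinuum.FouriersLaw.Theorems.ExtensiveSnapshotIrreversibility.ClausiusBudget
open Summit.AtomisticToContinuum.FouriersLaw.Theorems.HonestZwanzig
open Summit.AtomisticToContinuum.FouriersLaw.Theorems.BoundedResponse.TransientBand
open Summit.AtomisticToContinuum.FouriersLaw.Cruxes.SuperadditiveResistance.FloatingProbeBypassLaplacian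

namespace Summit.AtomisticToContinuum.FouriersLaw.Theorems.BoundedResponse.ParityFloor

open Summit.AtomisticToContinuum.FouriersLaw.Theses.BondHeatUncertainty (BoundedResponse ExtensiveSnapshotIrreversibility)
open Summit.AtomisticToContinuum.FouriersLaw.Theorems.SubdiffusiveBondHeat.EscapeGrading (OhmicFloor ExponentFloor)
open Summit.AtomisticToContinuum.FouriersLaw.Theorems.BoundedResponse.TransientBand
  (DeficitCesaroPoint TransientFloor DeficitCesaroGrade)

variable {N : ℕ}

section Pinned

variable {ω₂ lam β γ T : ℝ}

/-! ## §5 Statics: the odd `L²`-defect of a response density is `(γ²/T⁴)∫(h₀ − h₀∘Θ)² dμ_T` -/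

/-- `θ_b ∈ L¹(μ_T)`. [folklore] -/
theorem integrable_kinObs (hω : 0 < ω₂) (hl : 0 ≤ lam) (hβ : 0 ≤ β) (hT : 0 < T) (b : Fin N) :
    Integrable (kinObs T N b) ((pinnedChain ω₂ lam β γ).gibbsMeasure N T) := by
  have hϑ0 : (0 : ℝ) < 1 / (4 * T) := by positivity
  have hϑ1 : 1 / (4 * T) < 1 / T := by
    rw [one_div_lt_one_div (by positivity) hT]; linarith
  refine ((pinnedChain_integrable_exp_mul_hamiltonian_gibbsMeasure hω hl hβ γ N hT hϑ1).const_mul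
    (2 / (1 / (4 * T)) + T)).mono' (continuous_kinObs T b).aestronglyMeasurable (Eventually.of_forall fun y => ?_)
  rw [Real.norm_eq_abs]
  exact abs_kinObs_le hω hl hβ hT.le hϑ0 b y

/-- Linearity of `P_t` on `span{θ_a, θ_b}`: `P_t(a₁θ_{b₁} + a₂θ_{b₂}) = a₁v^{b₁}_t + a₂v^{b₂}_t`. [folklore] -/
theorem act_lin (hω : 0 < ω₂) (hl : 0 ≤ lam) (hβ : 0 ≤ β) (hγ : 0 ≤ γ) (hN : 0 < N) (hT : 0 < T)
    (a₁ a₂ : ℝ) (b₁ b₂ : Fin N) (t : ℝ) (z : PhaseSpace N) :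
    ∫ y, (a₁ * kinObs T N b₁ y + a₂ * kinObs T N b₂ y) ∂((pinnedChain ω₂ lam β γ).transitionKernel N T T t.toNNReal z) =
      a₁ * kinAct ω₂ lam β γ T N b₁ t z + a₂ * kinAct ω₂ lam β γ T N b₂ t z := by
  have hϑ0 : (0 : ℝ) < 1 / (4 * T) := by positivity
  have hϑ1 : 1 / (4 * T) < 1 / T := by
    rw [one_div_lt_one_div (by positivity) hT]; linarith
  have i₁ := pinnedChain_integrable_transitionKernel_of_abs_le hω hl hN hT hβ hγ hϑ0 hϑ1 (continuous_kinObs T b₁)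
    (fun y => abs_kinObs_le (γ := γ) hω hl hβ hT.le hϑ0 b₁ y) t.toNNReal z
  have i₂ := pinnedChain_integrable_transitionKernel_of_abs_le hω hl hN hT hβ hγ hϑ0 hϑ1 (continuous_kinObs T b₂)
    (fun y => abs_kinObs_le (γ := γ) hω hl hβ hT.le hϑ0 b₂ y) t.toNNReal z
  unfold kinAct
  rw [integral_add (i₁.const_mul a₁) (i₂.const_mul a₂), integral_const_mul, integral_const_mul]

/-- Linearity of `R₀` on `span{θ_a, θ_b}`: `R₀(a₁θ_{b₁} + a₂θ_{b₂}) = a₁h_{b₁} + a₂h_{b₂}` pointwise. [folklore] -/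
theorem kubo_lin (hω : 0 < ω₂) (hl : 0 ≤ lam) (hβ : 0 < β) (hγ : 0 < γ) (hN : 0 < N) (hT : 0 < T) {ϑ K c : ℝ}
    (hϑ0 : 0 < ϑ)
    (hb : ∀ (z : PhaseSpace N) (t : ℝ≥0) (f : PhaseSpace N → ℝ), Continuous f → ∀ C : ℝ, 0 ≤ C →
      (∀ y, |f y| ≤ C * Real.exp (ϑ * (pinnedChain ω₂ lam β γ).hamiltonian N y)) →
      |(∫ y, f y ∂((pinnedChain ω₂ lam β γ).transitionKernel N T T t z)) -
          ∫ y, f y ∂((pinnedChain ω₂ lam β γ).gibbsMeasure N T)| ≤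
        K * C * Real.exp (ϑ * (pinnedChain ω₂ lam β γ).hamiltonian N z) * Real.exp (-c * t))
    (hc : 0 < c) (a₁ a₂ : ℝ) (b₁ b₂ : Fin N) (z : PhaseSpace N) :
    ∫ t in Ioi (0 : ℝ), ∫ y, (a₁ * kinObs T N b₁ y + a₂ * kinObs T N b₂ y)
        ∂((pinnedChain ω₂ lam β γ).transitionKernel N T T t.toNNReal z) =
      a₁ * kinCorrector ω₂ lam β γ T N b₁ z + a₂ * kinCorrector ω₂ lam β γ T N b₂ z := by
  simp_rw [act_lin hω hl hβ.le hγ.le hN hT a₁ a₂ b₁ b₂]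
  have I₁ := (kinAct_integrableOn hω hl hβ hγ hT hϑ0 hb hc b₁ z).1
  have I₂ := (kinAct_integrableOn hω hl hβ hγ hT hϑ0 hb hc b₂ z).1
  unfold kinCorrector
  rw [integral_add (I₁.const_mul a₁) (I₂.const_mul a₂), integral_const_mul, integral_const_mul]

/-- **Kubo coboundary** `R₀(LΨ) = μ_T(Ψ) − Ψ` a.e., for a `C²` observable `Ψ` with `|Ψ| ≤ C_Ψ e^{ϑH}`,
`|LΨ| ≤ C_L e^{ϑH}`, `2ϑ < 1/T` — the resolvent coboundary `R_λ(LΨ) = λR_λΨ − Ψ` a.e. along `λ = 1/(n+1)` and the two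
Abel limits with rates (the tree's argument for the McLennan potential, run for a general `Ψ`).
[cite: KunduDharNarayan2009, eq. (reln3)] -/
theorem kubo_generator_ae_eq (hω : 0 < ω₂) (hl : 0 ≤ lam) (hβ : 0 < β) (hγ : 0 < γ) (hN : 2 ≤ N) (hT : 0 < T)
    {ϑ K c : ℝ} (hϑ0 : 0 < ϑ) (h2ϑ : 2 * ϑ < 1 / T) (hK : 0 ≤ K)
    (hb : ∀ (z : PhaseSpace N) (t : ℝ≥0) (f : PhaseSpace N → ℝ), Continuous f → ∀ C : ℝ, 0 ≤ C →
      (∀ y, |f y| ≤ C * Real.exp (ϑ * (pinnedChain ω₂ lam β γ).hamiltonian N y)) →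
      |(∫ y, f y ∂((pinnedChain ω₂ lam β γ).transitionKernel N T T t z)) -
          ∫ y, f y ∂((pinnedChain ω₂ lam β γ).gibbsMeasure N T)| ≤
        K * C * Real.exp (ϑ * (pinnedChain ω₂ lam β γ).hamiltonian N z) * Real.exp (-c * t))
    (hc : 0 < c) {Ψ : PhaseSpace N → ℝ} (hΨ2 : ContDiff ℝ 2 Ψ) {CΨ CL : ℝ} (hCΨ0 : 0 ≤ CΨ) (hCL0 : 0 ≤ CL)
    (hΨb : ∀ y, |Ψ y| ≤ CΨ * Real.exp (ϑ * (pinnedChain ω₂ lam β γ).hamiltonian N y))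
    (hLb : ∀ y, |(pinnedChain ω₂ lam β γ).generator N T T Ψ y| ≤
      CL * Real.exp (ϑ * (pinnedChain ω₂ lam β γ).hamiltonian N y)) :
    ∀ᵐ z ∂((pinnedChain ω₂ lam β γ).gibbsMeasure N T),
      ∫ t in Ioi (0 : ℝ), ∫ y, (pinnedChain ω₂ lam β γ).generator N T T Ψ y
        ∂((pinnedChain ω₂ lam β γ).transitionKernel N T T t.toNNReal z) =
      (∫ x, Ψ x ∂((pinnedChain ω₂ lam β γ).gibbsMeasure N T)) - Ψ z := by
  set P := pinnedChain ω₂ lam β γ with hP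
  set π := P.gibbsMeasure N T with hπ
  have hU : ContDiff ℝ ∞ P.U := pinnedChain_contDiff_U ω₂ lam β γ
  have hV : ContDiff ℝ ∞ P.V := pinnedChain_contDiff_V ω₂ lam β γ
  have hLc : Continuous (P.generator N T T Ψ) :=
    P.continuous_generator (hU.of_le (by norm_cast)) (hV.of_le (by norm_cast)) N T T hΨ2
  have hL0 : ∫ y, P.generator N T T Ψ y ∂π = 0 :=
    pinnedChain_integral_generator_gibbsMeasure_eq_zero hω hl hβ hγ hN hT hϑ0 h2ϑ hΨ2 hCΨ0 hCL0 hΨb hLb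
  -- the coboundary identities along `λ = 1/(n+1)`
  have hcob : ∀ n : ℕ, ∀ᵐ z ∂π, (∫ t in Ioi (0 : ℝ), Real.exp (-((1 / ((n : ℝ) + 1)) * t)) *
      ∫ y, P.generator N T T Ψ y ∂(P.transitionKernel N T T t.toNNReal z)) =
      (1 / ((n : ℝ) + 1)) * (∫ t in Ioi (0 : ℝ), Real.exp (-((1 / ((n : ℝ) + 1)) * t)) *
        ∫ y, Ψ y ∂(P.transitionKernel N T T t.toNNReal z)) - Ψ z :=
    fun n => pinnedChain_resolvent_coboundary hω hl hβ hγ hN hT hϑ0 h2ϑ hΨ2 hCΨ0 hCL0 hΨb hLb (by positivity)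
  have hall := ae_all_iff.2 hcob
  refine hall.mono fun z hz => ?_
  set E := Real.exp (ϑ * P.hamiltonian N z) with hE
  apply eq_of_sub_eq_zero
  apply eq_zero_of_abs_le_mul_eps (c := K * CL * E / c ^ 2 + K * CΨ * E / c)
  intro ε hε
  obtain ⟨n, hn⟩ := exists_nat_one_div_lt hε
  have hlam : (0 : ℝ) < 1 / ((n : ℝ) + 1) := by positivity
  have e1 := pinnedChain_abs_resolvent_sub_kubo_le hω hl hβ hγ hϑ0 hb hc hLc hCL0 hLb hL0 hlam z
  have e2 := pinnedChain_abs_abelMean_sub_le hω hl hβ hγ hϑ0 hb hc hΨ2.continuous hCΨ0 hΨb hlam z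
  rw [hz n] at e1
  rw [abs_sub_comm] at e1
  have hM : 0 ≤ K * CL * E / c ^ 2 + K * CΨ * E / c := by positivity
  calc _ ≤ |(∫ t in Ioi (0 : ℝ), ∫ y, P.generator N T T Ψ y ∂(P.transitionKernel N T T t.toNNReal z)) -
          ((1 / ((n : ℝ) + 1)) * (∫ t in Ioi (0 : ℝ), Real.exp (-((1 / ((n : ℝ) + 1)) * t)) *
            ∫ y, Ψ y ∂(P.transitionKernel N T T t.toNNReal z)) - Ψ z)| +
        |(1 / ((n : ℝ) + 1)) * (∫ t in Ioi (0 : ℝ), Real.exp (-((1 / ((n : ℝ) + 1)) * t)) *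
            ∫ y, Ψ y ∂(P.transitionKernel N T T t.toNNReal z)) - ∫ x, Ψ x ∂π| := by
        refine le_trans (le_of_eq ?_) (abs_add_le _ _)
        congr 1; ring
    _ ≤ (1 / ((n : ℝ) + 1)) * (K * CL * E) / c ^ 2 + (1 / ((n : ℝ) + 1)) * (K * CΨ * E) / c := add_le_add e1 e2
    _ = (K * CL * E / c ^ 2 + K * CΨ * E / c) * (1 / ((n : ℝ) + 1)) := by ring
    _ ≤ (K * CL * E / c ^ 2 + K * CΨ * E / c) * ε := mul_le_mul_of_nonneg_left hn.le hM

/-- **The energy coboundary makes `h₀ + h_{N−1}` even.** For `N ≥ 2`, `μ_T`-a.e.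
`h₀(z) + h_{N−1}(z) = (H(z) − μ_T(H))/γ` — since `LH = −γ(θ₀ + θ_{N−1})` (`generator_hamiltonian_two_baths`) and
`R₀(LH) = μ_T(H) − H` a.e. (`kubo_generator_ae_eq` with `Ψ = H`, `|H| ≤ ϑ⁻¹e^{ϑH}`). In particular the odd parts of `h₀`
and `h_{N−1}` are opposite. [cite: BonettoLebowitzReyBellet2000, §5.2 eq. (25)] -/
theorem kinCorrector_pair_ae_eq (hω : 0 < ω₂) (hl : 0 ≤ lam) (hβ : 0 < β) (hγ : 0 < γ) (hN : 2 ≤ N) (hT : 0 < T) :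
    ∀ᵐ z ∂((pinnedChain ω₂ lam β γ).gibbsMeasure N T),
      kinCorrector ω₂ lam β γ T N ⟨0, by omega⟩ z + kinCorrector ω₂ lam β γ T N ⟨N - 1, by omega⟩ z =
        ((pinnedChain ω₂ lam β γ).hamiltonian N z -
          ∫ x, (pinnedChain ω₂ lam β γ).hamiltonian N x ∂((pinnedChain ω₂ lam β γ).gibbsMeasure N T)) / γ := by
  set P := pinnedChain ω₂ lam β γ with hP
  have hN0 : 0 < N := by omega
  have hϑ0 : (0 : ℝ) < 1 / (4 * T) := by positivity
  have h2ϑ : 2 * (1 / (4 * T)) < 1 / T := by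
    rw [show 2 * (1 / (4 * T)) = 1 / (2 * T) by ring, one_div_lt_one_div (by positivity) hT]; linarith
  have hϑ1 : 1 / (4 * T) < 1 / T := by linarith
  obtain ⟨K, c, hK, hc, hb⟩ := harrisBound_exists hω hl hβ hγ hN0 hT hϑ0 hϑ1
  have hU : ContDiff ℝ ∞ P.U := pinnedChain_contDiff_U ω₂ lam β γ
  have hV : ContDiff ℝ ∞ P.V := pinnedChain_contDiff_V ω₂ lam β γ
  have hΨ2 : ContDiff ℝ 2 (P.hamiltonian N) := (P.contDiff_hamiltonian hU hV N).of_le (by norm_cast)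
  -- `|H| ≤ ϑ⁻¹ e^{ϑH}` (`H ≥ 0`, `x + 1 ≤ eˣ`)
  have hHb : ∀ y, |P.hamiltonian N y| ≤ 1 / (1 / (4 * T)) * Real.exp (1 / (4 * T) * P.hamiltonian N y) := fun y => by
    have h0 : 0 ≤ P.hamiltonian N y := pinnedChain_hamiltonian_nonneg hω.le hl hβ.le γ N y
    rw [abs_of_nonneg h0, one_div_one_div]
    have h1 := Real.add_one_le_exp (1 / (4 * T) * P.hamiltonian N y)
    have h4T : 0 ≤ 4 * T := by positivity
    have h3 := mul_le_mul_of_nonneg_left h1 h4T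
    have h4 : 4 * T * (1 / (4 * T) * P.hamiltonian N y + 1) = P.hamiltonian N y + 4 * T := by
      rw [mul_add, ← mul_assoc, mul_one_div_cancel (by positivity : (4 : ℝ) * T ≠ 0), one_mul, mul_one]
    linarith
  -- `LH = −γ(θ₀ + θ_{N−1})`
  have hPγ : P.γ = γ := rfl
  have hLform : ∀ y, P.generator N T T (P.hamiltonian N) y =
      (-γ) * kinObs T N ⟨0, hN0⟩ y + (-γ) * kinObs T N ⟨N - 1, by omega⟩ y := fun y => by
    rw [Literature.Barriers.AtomisticToContinuum.generator_hamiltonian_two_baths P hN T T y, hPγ]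
    simp only [kinObs]
    ring
  have hLb : ∀ y, |P.generator N T T (P.hamiltonian N) y| ≤
      γ * (2 * (2 / (1 / (4 * T)) + T)) * Real.exp (1 / (4 * T) * P.hamiltonian N y) := fun y => by
    rw [hLform y]
    have h1 := abs_kinObs_le (γ := γ) hω hl hβ.le hT.le hϑ0 ⟨0, hN0⟩ y
    have h2 := abs_kinObs_le (γ := γ) hω hl hβ.le hT.le hϑ0 ⟨N - 1, by omega⟩ y
    calc |(-γ) * kinObs T N ⟨0, hN0⟩ y + (-γ) * kinObs T N ⟨N - 1, by omega⟩ y|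
        ≤ |(-γ) * kinObs T N ⟨0, hN0⟩ y| + |(-γ) * kinObs T N ⟨N - 1, by omega⟩ y| := abs_add_le _ _
      _ = γ * |kinObs T N ⟨0, hN0⟩ y| + γ * |kinObs T N ⟨N - 1, by omega⟩ y| := by
          rw [abs_mul, abs_mul, abs_neg, abs_of_pos hγ]
      _ ≤ γ * ((2 / (1 / (4 * T)) + T) * Real.exp (1 / (4 * T) * P.hamiltonian N y)) +
            γ * ((2 / (1 / (4 * T)) + T) * Real.exp (1 / (4 * T) * P.hamiltonian N y)) := by gcongr
      _ = _ := by ring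
  have hcob := kubo_generator_ae_eq hω hl hβ hγ hN hT hϑ0 h2ϑ hK.le hb hc hΨ2 (by positivity)
    (by positivity) hHb hLb
  have hLfun : P.generator N T T (P.hamiltonian N) =
      fun y => (-γ) * kinObs T N ⟨0, hN0⟩ y + (-γ) * kinObs T N ⟨N - 1, by omega⟩ y := funext hLform
  filter_upwards [hcob] with z hz
  rw [hLfun, kubo_lin hω hl hβ hγ hN0 hT hϑ0 hb hc (-γ) (-γ) ⟨0, hN0⟩ ⟨N - 1, by omega⟩ z] at hz
  rw [eq_div_iff hγ.ne']
  linear_combination (-1 : ℝ) * hz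

/-- **The odd defect of a response density.** For `N ≥ 2`, a steady-state family `μ` of the pinned chain with weak-NESS
uniqueness, and a response density `h` at `(N, T)`:
`oddDefect(μ_{N,T,T}) h = (γ²/T⁴) ∫ (h₀ − h₀∘Θ)² dμ_T` — because `μ_{N,T,T} = μ_T`, `h = ⟨h⟩ + (R₀g)∘Θ` a.e. with
`g = (γ/(2T²))(θ₀ − θ_{N−1})` (`pinnedChain_response_identification`), `R₀g = (γ/(2T²))(h₀ − h_{N−1})`, and
`h₀ + h_{N−1}` is `Θ`-even a.e. (`kinCorrector_pair_ae_eq`), so that `h − h∘Θ = (γ/T²)(h₀∘Θ − h₀)` a.e.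
[cite: KunduDharNarayan2009, eqs. (reln2)–(reln3)] [cite: MaesNetocny2010, Thm 3.1] -/
theorem oddDefect_eq_of_isResponseDensity (hω : 0 < ω₂) (hl : 0 < lam) (hβ : 0 < β) (hγ : 0 < γ)
    (hU : UniqueNESS ω₂ lam β γ) {μ : (N : ℕ) → ℝ → ℝ → Measure (PhaseSpace N)}
    (hμ : IsSteadyFamily ω₂ lam β γ μ) (hT : 0 < T) (hN : 2 ≤ N) {h : PhaseSpace N → ℝ}
    (hh : IsResponseDensity ω₂ lam β γ μ T N h) :
    oddDefect (μ N T T) h = γ ^ 2 / T ^ 4 * ∫ z, (kinCorrector ω₂ lam β γ T N ⟨0, by omega⟩ z -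
      kinCorrector ω₂ lam β γ T N ⟨0, by omega⟩ (z.1, -z.2)) ^ 2 ∂((pinnedChain ω₂ lam β γ).gibbsMeasure N T) := by
  set P := pinnedChain ω₂ lam β γ with hP
  obtain ⟨hmem, hresp, -⟩ := hh
  have hN0 : 0 < N := by omega
  haveI : IsProbabilityMeasure (P.gibbsMeasure N T) :=
    pinnedChain_isProbabilityMeasure_gibbsMeasure hω hl.le hβ.le γ N hT
  -- the steady state at `T_L = T_R = T` is the Gibbs measure
  have hG : μ N T T = P.gibbsMeasure N T :=
    hU N T T hT hT _ _ (hμ N T T hT hT) (pinnedChain_isSteadyState_gibbsMeasure hω hl.le hβ.le γ N hT)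
  -- the weak equation `L†h = −g`
  have hweak : ∀ F : PhaseSpace N → ℝ, ContDiff ℝ ∞ F → HasCompactSupport F →
      ∫ x, P.generator N T T F x * h x ∂(P.gibbsMeasure N T) =
        -∫ x, F x * (γ / (2 * T ^ 2) * (x.2 ⟨0, by omega⟩ ^ 2 - x.2 ⟨N - 1, by omega⟩ ^ 2)) ∂(P.gibbsMeasure N T) :=
    fun F hF hFc => integral_generator_mul_responseDensity_gibbs hN hT μ hμ hG hresp hF hFc
  rw [hG] at hmem
  rw [hG]
  -- a measurable representative `h'` of `h`, and the source in `θ`-form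
  have hh' : h =ᵐ[P.gibbsMeasure N T] hmem.1.mk h := hmem.1.ae_eq_mk
  have hh'm : Measurable (hmem.1.mk h) := hmem.1.stronglyMeasurable_mk.measurable
  have hmem' : MemLp (hmem.1.mk h) 2 (P.gibbsMeasure N T) := (memLp_congr_ae hh').1 hmem
  have hweak' : ∀ F : PhaseSpace N → ℝ, ContDiff ℝ ∞ F → HasCompactSupport F →
      ∫ x, P.generator N T T F x * hmem.1.mk h x ∂(P.gibbsMeasure N T) =
        -∫ x, F x * (γ / (2 * T ^ 2) * kinObs T N ⟨0, hN0⟩ x + (-(γ / (2 * T ^ 2))) * kinObs T N ⟨N - 1, by omega⟩ x)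
          ∂(P.gibbsMeasure N T) := by
    intro F hF hFc
    have e : ∫ x, F x * (γ / (2 * T ^ 2) * kinObs T N ⟨0, hN0⟩ x + (-(γ / (2 * T ^ 2))) * kinObs T N ⟨N - 1, by omega⟩ x)
          ∂(P.gibbsMeasure N T) =
        ∫ x, F x * (γ / (2 * T ^ 2) * (x.2 ⟨0, by omega⟩ ^ 2 - x.2 ⟨N - 1, by omega⟩ ^ 2)) ∂(P.gibbsMeasure N T) :=
      integral_congr_ae (Eventually.of_forall fun x => by simp only [kinObs]; ring)
    rw [e, ← hweak F hF hFc]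
    exact integral_congr_ae (by filter_upwards [hh'] with x hx; rw [hx])
  -- constants and the Harris bound
  have hϑ0 : (0 : ℝ) < 1 / (4 * T) := by positivity
  have h2ϑ : 2 * (1 / (4 * T)) < 1 / T := by
    rw [show 2 * (1 / (4 * T)) = 1 / (2 * T) by ring, one_div_lt_one_div (by positivity) hT]; linarith
  have hϑ1 : 1 / (4 * T) < 1 / T := by linarith
  obtain ⟨K, c, hK, hc, hb⟩ := harrisBound_exists hω hl.le hβ hγ hN0 hT hϑ0 hϑ1
  -- the source `g = (γ/(2T²))(θ₀ − θ_{N−1})`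
  have hgc : Continuous fun x : PhaseSpace N =>
      γ / (2 * T ^ 2) * kinObs T N ⟨0, hN0⟩ x + (-(γ / (2 * T ^ 2))) * kinObs T N ⟨N - 1, by omega⟩ x :=
    (continuous_const.mul (continuous_kinObs T _)).add (continuous_const.mul (continuous_kinObs T _))
  have hgb : ∀ y : PhaseSpace N,
      |γ / (2 * T ^ 2) * kinObs T N ⟨0, hN0⟩ y + (-(γ / (2 * T ^ 2))) * kinObs T N ⟨N - 1, by omega⟩ y| ≤
        (|γ / (2 * T ^ 2)| * (2 / (1 / (4 * T)) + T) + |γ / (2 * T ^ 2)| * (2 / (1 / (4 * T)) + T)) *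
          Real.exp (1 / (4 * T) * P.hamiltonian N y) := fun y => by
    have h1 := abs_kinObs_le (γ := γ) hω hl.le hβ.le hT.le hϑ0 ⟨0, hN0⟩ y
    have h2 := abs_kinObs_le (γ := γ) hω hl.le hβ.le hT.le hϑ0 ⟨N - 1, by omega⟩ y
    calc |γ / (2 * T ^ 2) * kinObs T N ⟨0, hN0⟩ y + (-(γ / (2 * T ^ 2))) * kinObs T N ⟨N - 1, by omega⟩ y|
        ≤ |γ / (2 * T ^ 2) * kinObs T N ⟨0, hN0⟩ y| + |(-(γ / (2 * T ^ 2))) * kinObs T N ⟨N - 1, by omega⟩ y| :=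
          abs_add_le _ _
      _ = |γ / (2 * T ^ 2)| * |kinObs T N ⟨0, hN0⟩ y| + |γ / (2 * T ^ 2)| * |kinObs T N ⟨N - 1, by omega⟩ y| := by
          rw [abs_mul, abs_mul, abs_neg]
      _ ≤ |γ / (2 * T ^ 2)| * ((2 / (1 / (4 * T)) + T) * Real.exp (1 / (4 * T) * P.hamiltonian N y)) +
            |γ / (2 * T ^ 2)| * ((2 / (1 / (4 * T)) + T) * Real.exp (1 / (4 * T) * P.hamiltonian N y)) := by
          gcongr
      _ = _ := by ring
  have hge : ∀ y : PhaseSpace N,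
      (fun x : PhaseSpace N => γ / (2 * T ^ 2) * kinObs T N ⟨0, hN0⟩ x +
        (-(γ / (2 * T ^ 2))) * kinObs T N ⟨N - 1, by omega⟩ x) (y.1, -y.2) =
      (fun x : PhaseSpace N => γ / (2 * T ^ 2) * kinObs T N ⟨0, hN0⟩ x +
        (-(γ / (2 * T ^ 2))) * kinObs T N ⟨N - 1, by omega⟩ x) y := fun y => by
    simp only [kinObs_reversal]
  have hg0 : ∫ y, (γ / (2 * T ^ 2) * kinObs T N ⟨0, hN0⟩ y + (-(γ / (2 * T ^ 2))) * kinObs T N ⟨N - 1, by omega⟩ y)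
      ∂(P.gibbsMeasure N T) = 0 := by
    rw [integral_add ((integrable_kinObs hω hl.le hβ.le hT _).const_mul _)
      ((integrable_kinObs hω hl.le hβ.le hT _).const_mul _), integral_const_mul, integral_const_mul,
      integral_kinObs hω hl.le hβ.le hT, integral_kinObs hω hl.le hβ.le hT]
    ring
  -- identification `h' = ⟨h⟩ + (R₀ g)∘Θ` a.e., the pair identity, and their pull-backs along `Θ`
  have hid := pinnedChain_response_identification hω hl.le hβ hγ hN hT hϑ0 h2ϑ hh'm hmem' hgc (by positivity) hgb hge
    hg0 hweak'
  have hpair := kinCorrector_pair_ae_eq hω hl.le hβ hγ hN hT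
  have hqmp := (measurePreserving_reversal_gibbsMeasure P N T).quasiMeasurePreserving
  have hidΘ := hqmp.ae hid
  have hpairΘ := hqmp.ae hpair
  have hhΘ := hqmp.ae hh'
  simp only [momentumReversal_apply, neg_neg, Prod.mk.eta, OscillatorChain.hamiltonian_neg_momentum] at hidΘ hpairΘ hhΘ
  have hlin : ∀ w : PhaseSpace N, ∫ t in Ioi (0 : ℝ), ∫ y, (γ / (2 * T ^ 2) * kinObs T N ⟨0, hN0⟩ y +
      (-(γ / (2 * T ^ 2))) * kinObs T N ⟨N - 1, by omega⟩ y) ∂(P.transitionKernel N T T t.toNNReal w) =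
      γ / (2 * T ^ 2) * kinCorrector ω₂ lam β γ T N ⟨0, hN0⟩ w +
        (-(γ / (2 * T ^ 2))) * kinCorrector ω₂ lam β γ T N ⟨N - 1, by omega⟩ w :=
    fun w => kubo_lin hω hl.le hβ hγ hN0 hT hϑ0 hb hc _ _ _ _ w
  -- assemble
  unfold oddDefect
  rw [← integral_const_mul]
  refine integral_congr_ae ?_
  filter_upwards [hh', hhΘ, hid, hidΘ, hpair, hpairΘ] with z e0 e0' e1 e2 e3 e4
  rw [e0, e0', e1, e2, hlin (z.1, -z.2), hlin z]
  have e5 : kinCorrector ω₂ lam β γ T N ⟨N - 1, by omega⟩ (z.1, -z.2) =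
      kinCorrector ω₂ lam β γ T N ⟨N - 1, by omega⟩ z + kinCorrector ω₂ lam β γ T N ⟨0, hN0⟩ z -
        kinCorrector ω₂ lam β γ T N ⟨0, hN0⟩ (z.1, -z.2) := by linarith
  rw [e5]
  ring

end Pinned

/-! ## §6 (L) proved; the door of record loses a hypothesis -/

/-- **(L) `OvershootParityFloor` — PROVED.** For `N ≥ 2`, every response density `h` at `(N,T)` and every `t ≥ 0`:
`escapeTransient_N(t) ≥ −(T²/(2γ))·oddDefect(μ_{N,T,T}) h` — the dynamical floor `escapeTransient_ge`
(`≥ −(γ/(2T²))∫(h₀ − h₀∘Θ)²dμ_T`) and the static identity `oddDefect = (γ²/T⁴)∫(h₀ − h₀∘Θ)²dμ_T`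
(`oddDefect_eq_of_isResponseDensity`); `(T²/(2γ))·(γ²/T⁴) = γ/(2T²)`. [folklore] -/
theorem overshootParityFloor_holds : OvershootParityFloor := by
  intro ω₂ lam β γ hω hl hβ hγ hU μ hμ T hT N h hN hh t ht
  rw [oddDefect_eq_of_isResponseDensity hω hl hβ hγ hU hμ hT hN hh]
  have hdyn := escapeTransient_ge hω hl hβ hγ (show 0 < N by omega) hT ht
  have hγ0 : γ ≠ 0 := hγ.ne'
  have hT0 : T ≠ 0 := hT.ne'
  have e : ∀ X : ℝ, T ^ 2 / (2 * γ) * (γ ^ 2 / T ^ 4 * X) = γ / (2 * T ^ 2) * X := fun X => by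
    field_simp
  rw [e]
  exact hdyn

/-- **`TransientFloor 1` from (L₂) and (K) alone** ((L) discharged). [folklore] -/
theorem transientFloor_one_of_snapshotKL :
    SnapshotKLLowerExpansion → ExtensiveSnapshotIrreversibility → TransientFloor 1 :=
  transientFloor_one_of_snapshot overshootParityFloor_holds

/-- **THE DOOR OF RECORD, one hypothesis lighter: `(D) ∧ (L₂) ∧ (K) ⟹ BoundedResponse` (stmt-11071)** —
`boundedResponse_of_deficitCesaroPoint_snapshot` with (L) discharged by `overshootParityFloor_holds`. [folklore] -/
theorem boundedResponse_of_deficitCesaroPoint_snapshotKL :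
    DeficitCesaroPoint → SnapshotKLLowerExpansion → ExtensiveSnapshotIrreversibility → BoundedResponse :=
  fun hD => boundedResponse_of_deficitCesaroPoint_snapshot hD overshootParityFloor_holds

/-- The same door in the escape-exponent language: `(D) ∧ (L₂) ∧ (K) ⟹ OhmicFloor`. [folklore] -/
theorem ohmicFloor_of_deficitCesaroPoint_snapshotKL :
    DeficitCesaroPoint → SnapshotKLLowerExpansion → ExtensiveSnapshotIrreversibility → OhmicFloor :=
  fun hD => ohmicFloor_of_deficitCesaroPoint_snapshot hD overshootParityFloor_holds

/-- **The graded ladder, unconditionally in (L)**: `(O_s) ∧ (D_h) ⟹ ExponentFloor (2 − max s h)`. [folklore] -/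
theorem exponentFloor_of_grades' {s h : ℝ} : OddSnapshotGrade s → DeficitCesaroGrade h → ExponentFloor (2 - max s h) :=
  exponentFloor_of_parityFloor_grades overshootParityFloor_holds

/-- `(O_s) ⟹ TransientFloor s` for every grade `s`, unconditionally in (L). [folklore] -/
theorem transientFloor_of_grade {s : ℝ} : OddSnapshotGrade s → TransientFloor s :=
  transientFloor_of_parityFloor_grade overshootParityFloor_holds

end Summit.AtomisticToContinuum.FouriersLaw.Theorems.BoundedResponse.ParityFloor

end
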